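import Literature.Geometry.Kaehler.CyclotomicFortyTwoHodgeConjecture
import Literature.Geometry.Kaehler.CyclotomicTwentyEightHodgeConjecture
import Literature.Geometry.Kaehler.CyclotomicThirtySixHodgeConjecture
import HarnessLib

/-!
# The cyclotomic fields of degree `≤ 12`, COMPLETE: for every abelian variety with complex multiplication by `ℚ(ζ_d)`, `φ(d) ≤ 12`, EITHER the
# Hodge conjecture holds for all its powers, OR `d ∈ {21, 28, 36, 42}` and it is one of Dodson's simple degenerate sixfolds with `B³ ≠ D³`

Layer `Literature/Geometry/Kaehler`, namespace `Literature.Geometry.Kaehler.ComplexTorus`; lane `lit-hodgefound` (Track 2 foundations library), prover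
seat `lit-hodgefound-p10`, generation 34, closing row «A2-26 (φ(d) ≤ 12 complete)» (self-proposed 2026-08-28).  Theorems only (net debt 0).

Generation 33's `CyclotomicDegreeLeTwelveHodgeConjecture` proved the Hodge conjecture for all powers of every abelian variety with complex multiplication
by `ℚ(ζ_d)`, `φ(d) ≤ 12`, EXCEPT for `d ∈ {21, 28, 36, 42}` — the fields `ℚ(ζ₂₁) = ℚ(ζ₄₂)`, `ℚ(ζ₂₈)`, `ℚ(ζ₃₆)` with Galois group `C₂ × C₆`, where
DEGENERATE PRIMITIVE CM types exist (Dodson 1984, Thm. 3.2.1, `n = 6 = 3·2`: rank `n − l + 2 = 6`).  This generation's files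
`Cyclotomic{TwentyOne, TwentyEight, ThirtySix, FortyTwo}HodgeConjecture` settle those four: in each, `24` of the `64` types are primitive and
coset-balanced over an imaginary quadratic subfield (Weil type `(3,3)`), their varieties are SIMPLE SIXFOLDS WITH `B³ ⊗ ℂ ≠ D³ ⊗ ℂ`, and the other `40`
types give varieties satisfying the Hodge conjecture with all their powers.  This file states the union:

* **`hodgeConjectureFor_pow_or_exceptional_of_totient_le_twelve`** — THE DICHOTOMY for every `d > 2` with `φ(d) ≤ 12`, every `ℚ(ζ_d)`, every CM type,
  every realisation `A`: (`B•(Aⁿ) ⊗ ℂ = D•(Aⁿ) ⊗ ℂ` for all `n` AND the Hodge conjecture for every power of `A`) OR (`d ∈ {21, 28, 36, 42}`, `A` simple,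
  `dim A = 6`, `B³(A) ⊗ ℂ ≠ D³(A) ⊗ ℂ`);
* `hodgeConjectureFor_pow_of_not_isSimple_of_totient_le_twelve` — in particular every NON-SIMPLE abelian variety with complex multiplication by a
  cyclotomic field of degree `≤ 12` satisfies the Hodge conjecture with all its powers, and so does every one with `B³ = D³`
  (`hodgeConjectureFor_pow_of_hodgeClassSpan_three_eq_of_totient_le_twelve`);
* `exists_isSimple_exceptional_of_totient_eq_twelve` — the second branch is NOT EMPTY: for each `d ∈ {21, 28, 36, 42}` there is a simple CM abelian
  sixfold by `𝓞_{ℚ(ζ_d)}` with `B³ ≠ D³` (Shimura §6.2 Thm. 3);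
* tori: **`divisorClasses_powPeriod_eq_hodgeClasses_of_charpoly_eq_cyclotomic_of_totient_le_twelve'`** — `Hdg(Xᵏ) = Div(Xᵏ)` for all `k` for every
  complex torus with an endomorphism of characteristic polynomial `Φ_d`, `d > 2`, `φ(d) ≤ 12`, PROVIDED that, when `d ∈ {21, 28, 36, 42}` and `X` is
  simple, `rank MT(X) = 7` (for those `d` the simple tori have `rank MT ∈ {7, 6}` and both occur).

HONEST SCOPE: the Hodge conjecture for the `4 × 24` families of simple degenerate sixfolds themselves (algebraicity of their Weil classes) is not
asserted anywhere in the tree.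

## References

* [Dodson1984] B. Dodson, *The structure of Galois groups of CM-fields*, Trans. AMS 283 (1984), §3.1.0, Thm. 3.2.1.
* [Gordon1999HodgeAVSurvey] B. B. Gordon (1999), 5.13 (ii), Thm. 6.3, Thm. 6.4, 7.5, §9.3, 9.4.3.
* [Shimura1998] G. Shimura, *Abelian Varieties with Complex Multiplication and Modular Functions* (1998), §6.2 Thm. 3, §8.2 Prop. 26, §8.4.
* [MoonenZarhin1999LowDim] B. Moonen, Yu. Zarhin, Math. Ann. 315 (1999), Thm. 0.1, §2 (2.7).
* [Washington1997] L. C. Washington, *Introduction to Cyclotomic Fields*, Ch. 2.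
-/

noncomputable section

open scoped Classical nonZeroDivisors NumberField Manifold ContDiff MatrixGroups
open NumberField Module Polynomial CategoryTheory CategoryTheory.Limits

namespace Literature.Geometry.Kaehler

namespace ComplexTorus

-- `open scoped`: the tree's action of `Aut(ℂ)` on `Hom(K, ℂ)` by composition (`ringEquivCompAction`) is a scoped instance
open scoped Literature.NumberTheory.ComplexMultiplication
open Literature.AlgebraicGeometry.Motives (CMType AbelianVariety HodgeTensorFacts)
open Literature.AlgebraicGeometry.HodgeTheory (HodgeConjectureFor complexBetti)
open Literature.AlgebraicGeometry.VanGeemen1994 (hodgeClassSpan)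
open Literature.Barriers.HodgeConjecture (divisorClassesSpan)
open Literature.NumberTheory.ComplexMultiplication (IsPrimitive)
open Literature.AlgebraicGeometry.ComplexMultiplication (IsCMTypeRealisation)

/-! ### §1 Varieties -/

section Varieties

variable {d : ℕ} {K : Type} [Field K] [NumberField K]
  {A : AbelianVariety ℂ} {ι : 𝓞 K →+* End A} {θ : K →+* Module.End ℂ (complexBetti A.X 1)}

/-- `Bᵐ ⊗ ℂ = Dᵐ ⊗ ℂ` for all `m` on an abelian variety gives the Hodge conjecture for it. [cite: Gordon1999HodgeAVSurvey, §9.3] -/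
private theorem hodgeConjectureFor_of_forall_hodgeClassSpan_eq₆₃ (B : AbelianVariety ℂ)
    (h : ∀ m : ℕ, hodgeClassSpan B.dim B.X m = divisorClassesSpan B.X B.dim m) : HodgeConjectureFor B.dim B.X :=
  ⟨Literature.AlgebraicGeometry.HodgeTheory.nonempty_hodgeModel_holds
      (Literature.AlgebraicGeometry.Motives.AbelianVariety.isSmoothProjective_holds (A := B)),
    fun m _ hc hmm ↦ Literature.AlgebraicGeometry.HodgeTheory.AbelianVariety.divisorClassesSpan_le_algebraicClasses B
      (fun b hb hb' ↦ Literature.AlgebraicGeometry.HodgeTheory.lefschetzOneOne_rational_holds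
        (Literature.AlgebraicGeometry.Motives.AbelianVariety.isSmoothProjective_holds (A := B)) b hb hb') m
      ((h m) ▸ Submodule.subset_span ⟨hc, hmm⟩)⟩

/-- **THE DICHOTOMY FOR THE CM ABELIAN VARIETIES OF THE CYCLOTOMIC FIELDS OF DEGREE `≤ 12`.**  Let `d > 2`, `φ(d) ≤ 12`, `K = ℚ(ζ_d)`, `Φ` any CM type
of `K` and `(A, ι, θ)` any realisation.  Then EITHER `B•(Aⁿ) ⊗ ℂ = D•(Aⁿ) ⊗ ℂ` for all `n` and the Hodge conjecture holds for every power of `A`, OR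
`d ∈ {21, 28, 36, 42}`, `A` is simple of dimension `6` and `B³(A) ⊗ ℂ ≠ D³(A) ⊗ ℂ` (Dodson's degenerate primitive types: coset-balanced over an
imaginary quadratic subfield, Weil type `(3,3)`). [cite: Gordon1999HodgeAVSurvey, Thm. 6.3, Thm. 6.4, §9.3 and 5.13 (ii)] [cite: Dodson1984, Thm. 3.2.1]
[cite: Shimura1998, §8.4 Example (1)] -/
theorem hodgeConjectureFor_pow_or_exceptional_of_totient_le_twelve (hK : IsCyclotomicExtension {d} ℚ K) (hd : 2 < d)
    (h12 : Nat.totient d ≤ 12) (Φ : CMType K) (hA : IsCMTypeRealisation Φ A ι θ) :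
    ((∀ n m : ℕ, hodgeClassSpan (⨁ fun _ : Fin n => A).dim (⨁ fun _ : Fin n => A).X m =
        divisorClassesSpan (⨁ fun _ : Fin n => A).X (⨁ fun _ : Fin n => A).dim m) ∧
      ∀ n : ℕ, HodgeConjectureFor (⨁ fun _ : Fin n => A).dim (⨁ fun _ : Fin n => A).X) ∨
    ((d = 21 ∨ d = 28 ∨ d = 36 ∨ d = 42) ∧ A.IsSimple ∧ A.dim = 6 ∧ hodgeClassSpan 6 A.X 3 ≠ divisorClassesSpan A.X 6 3) := by
  obtain ⟨φ₀⟩ : Nonempty (K →+* ℂ) := inferInstance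
  by_cases hex : d ≠ 21 ∧ d ≠ 28 ∧ d ≠ 36 ∧ d ≠ 42
  · exact Or.inl ⟨fun n m ↦ (hodgeClassSpan_pow_eq_and_hodgeConjectureFor_pow_of_totient_le_twelve hK hd h12 hex Φ hA n m).1,
      fun n ↦ (hodgeClassSpan_pow_eq_and_hodgeConjectureFor_pow_of_totient_le_twelve hK hd h12 hex Φ hA n 0).2⟩
  · have hd' : d = 21 ∨ d = 28 ∨ d = 36 ∨ d = 42 := by
      by_contra hc
      exact hex ⟨fun h ↦ hc (Or.inl h), fun h ↦ hc (Or.inr (Or.inl h)), fun h ↦ hc (Or.inr (Or.inr (Or.inl h))),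
        fun h ↦ hc (Or.inr (Or.inr (Or.inr h)))⟩
    rcases hd' with rfl | rfl | rfl | rfl
    · rcases hodgeConjectureFor_pow_or_exceptional_twentyOne hK Φ φ₀ hA with h | ⟨-, -, hS, hdim, hne⟩
      · exact Or.inl h
      · exact Or.inr ⟨Or.inl rfl, hS, hdim, hne⟩
    · rcases hodgeConjectureFor_pow_or_exceptional_twentyEight hK Φ φ₀ hA with h | ⟨-, -, hS, hdim, hne⟩
      · exact Or.inl h
      · exact Or.inr ⟨Or.inr (Or.inl rfl), hS, hdim, hne⟩
    · rcases hodgeConjectureFor_pow_or_exceptional_thirtySix hK Φ φ₀ hA with h | ⟨-, -, hS, hdim, hne⟩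
      · exact Or.inl h
      · exact Or.inr ⟨Or.inr (Or.inr (Or.inl rfl)), hS, hdim, hne⟩
    · rcases hodgeConjectureFor_pow_or_exceptional_fortyTwo hK Φ hA with h | ⟨hS, hdim, hne⟩
      · exact Or.inl h
      · exact Or.inr ⟨Or.inr (Or.inr (Or.inr rfl)), hS, hdim, hne⟩

/-- **Every NON-SIMPLE abelian variety with complex multiplication by a cyclotomic field of degree `≤ 12` satisfies the Hodge conjecture with all
its powers** (and `B = D` on all of them). [cite: Gordon1999HodgeAVSurvey, Thm. 6.3 and §9.3] [cite: MoonenZarhin1999LowDim, Thm. 0.1] -/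
theorem hodgeConjectureFor_pow_of_not_isSimple_of_totient_le_twelve (hK : IsCyclotomicExtension {d} ℚ K) (hd : 2 < d)
    (h12 : Nat.totient d ≤ 12) (Φ : CMType K) (hA : IsCMTypeRealisation Φ A ι θ) (hns : ¬ A.IsSimple) (n : ℕ) :
    (∀ m : ℕ, hodgeClassSpan (⨁ fun _ : Fin n => A).dim (⨁ fun _ : Fin n => A).X m =
        divisorClassesSpan (⨁ fun _ : Fin n => A).X (⨁ fun _ : Fin n => A).dim m) ∧
      HodgeConjectureFor (⨁ fun _ : Fin n => A).dim (⨁ fun _ : Fin n => A).X := by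
  rcases hodgeConjectureFor_pow_or_exceptional_of_totient_le_twelve hK hd h12 Φ hA with ⟨h1, h2⟩ | ⟨-, hS, -⟩
  · exact ⟨h1 n, h2 n⟩
  · exact absurd hS hns

/-- **`B³(A) ⊗ ℂ = D³(A) ⊗ ℂ` suffices**: an abelian variety with complex multiplication by a cyclotomic field of degree `≤ 12` whose weight-`6` Hodge
classes are generated by divisor classes satisfies the Hodge conjecture with all its powers. [cite: Gordon1999HodgeAVSurvey, §9.3 and 5.13 (ii)]
[cite: Dodson1984, Thm. 3.2.1] -/
theorem hodgeConjectureFor_pow_of_hodgeClassSpan_three_eq_of_totient_le_twelve (hK : IsCyclotomicExtension {d} ℚ K) (hd : 2 < d)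
    (h12 : Nat.totient d ≤ 12) (Φ : CMType K) (hA : IsCMTypeRealisation Φ A ι θ)
    (h3 : hodgeClassSpan 6 A.X 3 = divisorClassesSpan A.X 6 3) (n : ℕ) :
    HodgeConjectureFor (⨁ fun _ : Fin n => A).dim (⨁ fun _ : Fin n => A).X := by
  rcases hodgeConjectureFor_pow_or_exceptional_of_totient_le_twelve hK hd h12 Φ hA with ⟨-, h2⟩ | ⟨-, -, -, hne⟩
  · exact h2 n
  · exact absurd h3 hne

/-- **The Hodge conjecture for the variety itself** in the first branch (`n = 1` is `A`; stated for `A` directly through `B = D` in all degrees).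
[cite: Gordon1999HodgeAVSurvey, §9.3] -/
theorem hodgeConjectureFor_or_exceptional_of_totient_le_twelve (hK : IsCyclotomicExtension {d} ℚ K) (hd : 2 < d)
    (h12 : Nat.totient d ≤ 12) (Φ : CMType K) (hA : IsCMTypeRealisation Φ A ι θ) :
    HodgeConjectureFor A.dim A.X ∨
    ((d = 21 ∨ d = 28 ∨ d = 36 ∨ d = 42) ∧ A.IsSimple ∧ A.dim = 6 ∧ hodgeClassSpan 6 A.X 3 ≠ divisorClassesSpan A.X 6 3) := by
  haveI : NeZero d := ⟨by omega⟩
  haveI : IsCMField K := IsCyclotomicExtension.Rat.isCMField K (S := ({d} : Set ℕ)) ⟨d, rfl, hd⟩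
  haveI : IsAbelianGalois ℚ K := IsCyclotomicExtension.isAbelianGalois {d} ℚ K
  rcases hodgeConjectureFor_pow_or_exceptional_of_totient_le_twelve hK hd h12 Φ hA with ⟨h1, -⟩ | h
  · refine Or.inl (hodgeConjectureFor_of_forall_hodgeClassSpan_eq₆₃ A ?_)
    have hdim : A.dim = Module.finrank ℚ K / 2 := Literature.AlgebraicGeometry.Motives.schemeDim_eq_holds hA.1
    rw [hdim]
    exact (Literature.AlgebraicGeometry.Pohlmann1968.forall_pow_hodgeClassSpan_eq_iff_forall_hodgeClassSpan_eq hA).1 h1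
  · exact Or.inr h

/-- **THE SECOND BRANCH IS NOT EMPTY**: for each `d ∈ {21, 28, 36, 42}` there is a SIMPLE abelian sixfold with complex multiplication by `𝓞_{ℚ(ζ_d)}` and
`B³ ≠ D³`, and one all of whose powers satisfy the Hodge conjecture. [cite: Shimura1998, §6.2 Thm. 3] [cite: Dodson1984, Thm. 3.2.1] -/
theorem exists_isSimple_exceptional_of_totient_eq_twelve (hK : IsCyclotomicExtension {d} ℚ K) (hd : d = 21 ∨ d = 28 ∨ d = 36 ∨ d = 42) :
    (∃ (Φ : CMType K) (A : AbelianVariety ℂ) (ι' : 𝓞 K →+* End A) (θ' : K →+* Module.End ℂ (complexBetti A.X 1)),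
      IsCMTypeRealisation Φ A ι' θ' ∧ A.IsSimple ∧ A.dim = 6 ∧ hodgeClassSpan 6 A.X 3 ≠ divisorClassesSpan A.X 6 3) ∧
    (∃ (Φ : CMType K) (A : AbelianVariety ℂ) (ι' : 𝓞 K →+* End A) (θ' : K →+* Module.End ℂ (complexBetti A.X 1)),
      IsCMTypeRealisation Φ A ι' θ' ∧ A.IsSimple ∧ A.dim = 6 ∧
        ∀ n : ℕ, HodgeConjectureFor (⨁ fun _ : Fin n => A).dim (⨁ fun _ : Fin n => A).X) := by
  rcases hd with rfl | rfl | rfl | rfl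
  · haveI := hK; exact exists_isSimple_exceptional_twentyOne K
  · haveI := hK; exact exists_isSimple_exceptional_twentyEight K
  · haveI := hK; exact exists_isSimple_exceptional_thirtySix K
  · haveI := hK; exact exists_isSimple_exceptional_fortyTwo

end Varieties

/-! ### §2 Complex tori with `P_u = Φ_d`, `φ(d) ≤ 12` -/

section Tori

variable {ι : Type} [Fintype ι] [DecidableEq ι] {E : Type} [NormedAddCommGroup E] [NormedSpace ℂ E]
  {P : (ι → ℝ) ≃L[ℝ] E} {d : ℕ}

/-- **`Hdg(Xᵏ) = Div(Xᵏ)` FOR ALL `k`, FOR EVERY COMPLEX TORUS WITH AN ENDOMORPHISM OF CHARACTERISTIC POLYNOMIAL `Φ_d`, `d > 2`, `φ(d) ≤ 12`** — provided that,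
for `d ∈ {21, 28, 36, 42}` and `X` simple, `rank MT(X) = 7` (in those four cases `rank MT(X) ∈ {7, 6}` for the simple `X`, and `Hdg = Div` on all powers
iff `7`). [cite: MoonenZarhin1999LowDim, Thm. 0.1] [cite: Gordon1999HodgeAVSurvey, Thm. 6.3 (2), 7.5] [cite: Dodson1984, Thm. 3.2.1] -/
theorem divisorClasses_powPeriod_eq_hodgeClasses_of_charpoly_eq_cyclotomic_of_totient_le_twelve' [HodgeTensorFacts.{0, 0}] (hd : 2 < d)
    (h12 : Nat.totient d ≤ 12) {A : Matrix ι ι ℤ} (hA : A ∈ endRingInt P) (hP : A.charpoly = cyclotomic d ℤ)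
    (h7 : (d = 21 ∨ d = 28 ∨ d = 36 ∨ d = 42) → ComplexTorus.IsSimple P → (hodgeStructure P 1).mtRank = 7) (k p : ℕ) :
    divisorClasses (powPeriod P k) p = hodgeClasses (powPeriod P k) p := by
  by_cases hex : d ≠ 21 ∧ d ≠ 28 ∧ d ≠ 36 ∧ d ≠ 42
  · exact divisorClasses_powPeriod_eq_hodgeClasses_of_charpoly_eq_cyclotomic_of_totient_le_twelve hd h12 hex hA hP k p
  · have hd' : d = 21 ∨ d = 28 ∨ d = 36 ∨ d = 42 := by
      by_contra hc
      exact hex ⟨fun h ↦ hc (Or.inl h), fun h ↦ hc (Or.inr (Or.inl h)), fun h ↦ hc (Or.inr (Or.inr (Or.inl h))),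
        fun h ↦ hc (Or.inr (Or.inr (Or.inr h)))⟩
    have h7' := h7 hd'
    rcases hd' with rfl | rfl | rfl | rfl
    · exact divisorClasses_powPeriod_eq_hodgeClasses_of_twentyOne hA hP h7' k p
    · exact divisorClasses_powPeriod_eq_hodgeClasses_of_twentyEight hA hP h7' k p
    · exact divisorClasses_powPeriod_eq_hodgeClasses_of_thirtySix hA hP h7' k p
    · exact divisorClasses_powPeriod_eq_hodgeClasses_of_fortyTwo hA hP h7' k p

/-- **For SIMPLE tori with `P_u = Φ_d`, `d ∈ {21, 28, 36, 42}`: `rank MT(X) ∈ {7, 6}`, and `Hdg = Div` on all powers iff `rank MT(X) = 7`.**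
[cite: Dodson1984, §3.1.0 and Thm. 3.2.1] [cite: Gordon1999HodgeAVSurvey, 7.5] -/
theorem mtRank_hodgeStructure_eq_seven_or_six_of_isSimple [HodgeTensorFacts.{0, 0}] (hd : d = 21 ∨ d = 28 ∨ d = 36 ∨ d = 42)
    (hX : ComplexTorus.IsSimple P) {A : Matrix ι ι ℤ} (hA : A ∈ endRingInt P) (hP : A.charpoly = cyclotomic d ℤ) :
    ((hodgeStructure P 1).mtRank = 7 ∨ (hodgeStructure P 1).mtRank = 6) ∧
      ((∀ k p : ℕ, divisorClasses (powPeriod P k) p = hodgeClasses (powPeriod P k) p) ↔ (hodgeStructure P 1).mtRank = 7) := by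
  rcases hd with rfl | rfl | rfl | rfl
  · exact ⟨hX.mtRank_hodgeStructure_eq_seven_or_six_twentyOne hA hP, forall_divisorClasses_powPeriod_eq_hodgeClasses_iff_of_isSimple_twentyOne hX hA hP⟩
  · exact ⟨hX.mtRank_hodgeStructure_eq_seven_or_six_twentyEight hA hP,
      forall_divisorClasses_powPeriod_eq_hodgeClasses_iff_of_isSimple_twentyEight hX hA hP⟩
  · exact ⟨hX.mtRank_hodgeStructure_eq_seven_or_six_thirtySix hA hP, forall_divisorClasses_powPeriod_eq_hodgeClasses_iff_of_isSimple_thirtySix hX hA hP⟩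
  · exact ⟨hX.mtRank_hodgeStructure_eq_seven_or_six_fortyTwo hA hP, forall_divisorClasses_powPeriod_eq_hodgeClasses_iff_of_isSimple_fortyTwo hX hA hP⟩

end Tori

end ComplexTorus

end Literature.Geometry.Kaehler

end
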